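import Summits.QuantumFields.BalabanUV.T4Continuum.Support.ScalarPlantingFaces

/-!
# T⁴ programme, spine node NE2 (U1a) — THE COLOUR SCALAR LAYER, file 2b: THE THREE TWO-LEVEL (H-cons) BOUNDS — first order,
# adjoint first order, zeroth order — for the scalar-layer perturbation against King's 0-form planting (tier B, supplier row B4.e)

NE2 formalisation swarm `b2b-balaban-t4-ne2-formalise-*`, leaf 01 (row B4.e, file 2b; companion of `Support/ScalarPlantingFaces`).  With
`P_s = F + Fᴴ + siteMul z + a′·(Gram)` (`ScalarCovariantLaplacian.scalarPert_eq`), `F = Σ_μ siteMul(v_μ)·(∂_μ ⊗ 1)`, the consistency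
`‖(G′_{RN} ⊗ 1)·(P′J₀ − J₀P)·(G′_N ⊗ 1)‖` of the three LOCAL shapes at two adjacent spacings `N`, `R·N` is controlled — exactly as in the
lineage's tier-A files `FirstOrderBackgroundModel` §3 / `FirstOrderAdjointModel` §3 / `PerturbationAlgebra` (1-forms, `calDalev`), here
RE-PROVED ON COLOUR 0-FORMS over the `DeltaPs` tower of row B4.c — by three numbers on the data and ONE free number:
 * §1 zeroth order **`opNorm_zeroth_consistency0_le`**: `‖G′(siteMul z′·J₀ − J₀·siteMul z)G‖ ≤ g·δ·g` from `‖z′ − z ∘ par‖ ≤ δ`;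
 * §2 first order: the EXACT DECOMPOSITION **`consistency_decomp0`**
   `siteMul v′·∂′J₀ − J₀·siteMul v·∂ = R·(siteMul v′ − siteMul(v ∘ par))·F₀J₀·∂ + (1 − Π₀)·(R·F₀ − 1)J₀·siteMul v·∂` and
   **`opNorm_consistency0_le`** `≤ R·g·δ·√g + e_c·(R + 1)·α·√g` (`‖v‖ ≤ α`, `‖v′ − v ∘ par‖ ≤ δ`, the complement number
   `‖(G′_{RN}(1 − Π₀)) ⊗ 1‖ ≤ e_c` of the free scalar tower, row B4.d);
 * §3 adjoint first order: **`adjoint_consistency_decomp0`**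
   `∂′ᴴ·siteMul v′·J₀ − J₀·∂ᴴ·siteMul v = ∂′ᴴ·(siteMul v′ − siteMul(v ∘ par))·J₀ + (1 − Π₀)·(∂′ᴴJ₀ − J₀∂ᴴ)·siteMul v` and
   **`opNorm_adjoint_consistency0_le`** `≤ √g·δ·g + e_c·(R + 1)·(α√g + βg)` (one Leibniz commutation, lattice-Lipschitz `β/N`).
Inputs BY NAME: row B4.c (`opNorm_Gps_le`, `opNorm_sdiff_mul_Gps_le`, `Gps_isHermitian`; positivity, no (1.89)), file 2a (`sdiff_mul_JK0`,
`Pi0_mul_face_defect_mul_JK0`, `Pi0_mul_adjoint_defect0`, `kronJK0_mul_siteMul`, the one-derivative bounds), leaf 04's `JK0`/`Pi0`.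

HONEST FRAMING (T4-DAG p. 1).  [folklore] finite-lattice bookkeeping, OURS; backgrounds `v`, `z` are DATA; `U = 1` free objects; NOT [B9]
(3.23)–(3.26) as printed; NE2 NOT proved; spine count 0/9 UNCHANGED; NOT infinite volume / mass gap / Clay.  HONEST DEPENDENCY LINE:
continuum YM on T⁴ ⇐ BetaPertH ∧ nine spine estimates (0/9 proved); BetaPertH ⇐ (D1) ∧ (D4) ∧ CAP+tail; G-an2-4 gates asym, D1 and
NE2/3/4.  ABSOLUTE RULE kept; no `sorry`.
-/

noncomputable section

open scoped BigOperators ComplexConjugate Matrix Matrix.Norms.L2Operator Kronecker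

namespace Summit.QuantumFields.BalabanUV.T4Continuum.ScalarPlantingConsistency

open Literature.MathematicalPhysics.QuantumFieldTheory.Balaban1983to89.B5Prop11Plancherel (Tor fine unitVec)
open Literature.MathematicalPhysics.QuantumFieldTheory.Balaban1983to89.B5Action121 (shiftS sdiff)
open Summit.QuantumFields.BalabanUV.T4Continuum
open Summit.QuantumFields.BalabanUV.T4Continuum.KroneckerLift
open Summit.QuantumFields.BalabanUV.T4Continuum.BlockMultiplication
open Summit.QuantumFields.BalabanUV.T4Continuum.BalabanAveragedTowerModes (par)
open Summit.QuantumFields.BalabanUV.T4Continuum.GaugeTermDecomposition (opNorm_shiftS_le)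
open Summit.QuantumFields.BalabanUV.T4Continuum.ScalarAveragedPropagator (gammaPs Gps gammaPs_pos Gps_isHermitian opNorm_Gps_le
  opNorm_sdiff_mul_Gps_le opNorm_Gps_mul_sdiffH_le)
open Summit.QuantumFields.BalabanUV.T4Continuum.ScalarBlockPlanting (JK0 Pi0 JK0_mul_conjTranspose opNorm_JK0_le)
open Summit.QuantumFields.BalabanUV.T4Continuum.ScalarCovariantLaplacian (kronSdiff_conjTranspose kronSdiff_mul_siteMul)
open Summit.QuantumFields.BalabanUV.T4Continuum.ScalarPlantingFaces

variable {d : ℕ} {o : Type*} [Fintype o] [DecidableEq o]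

section TwoLevel

variable (N R : ℕ) [NeZero N] [NeZero R] (M : Fin d → ℕ) [hM : ∀ μ, NeZero (M μ)]

/-! ## §1 Zeroth order -/

/-- `siteMul z′·(J₀ ⊗ 1) − (J₀ ⊗ 1)·siteMul z = (siteMul z′ − siteMul (z ∘ par))·(J₀ ⊗ 1)`. [folklore] -/
theorem zeroth_consistency_decomp0 (z' : Tor (fine (R * N) M) → Matrix o o ℂ) (z : Tor (fine N M) → Matrix o o ℂ) :
    siteMul z' * JK0 N R M ⊗ₖ (1 : Matrix o o ℂ) - JK0 N R M ⊗ₖ (1 : Matrix o o ℂ) * siteMul z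
      = (siteMul z' - siteMul (z ∘ par N R M)) * JK0 N R M ⊗ₖ (1 : Matrix o o ℂ) := by
  rw [kronJK0_mul_siteMul, Matrix.sub_mul]

/-- **ZEROTH-ORDER (H-cons) AT TWO LEVELS**: `‖(G′ ⊗ 1)(siteMul z′·J₀ − J₀·siteMul z)(G′ ⊗ 1)‖ ≤ g·δ·g`. [folklore] -/
theorem opNorm_zeroth_consistency0_le {a' : ℝ} (ha' : 0 < a') {z' : Tor (fine (R * N) M) → Matrix o o ℂ}
    {z : Tor (fine N M) → Matrix o o ℂ} {δ : ℝ} (hδ : 0 ≤ δ) (hcons : ∀ x', ‖z' x' - z (par N R M x')‖ ≤ δ) :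
    ‖Gps (R * N) M a' ⊗ₖ (1 : Matrix o o ℂ) * (siteMul z' * JK0 N R M ⊗ₖ (1 : Matrix o o ℂ) - JK0 N R M ⊗ₖ (1 : Matrix o o ℂ) * siteMul z)
        * (Gps N M a' ⊗ₖ (1 : Matrix o o ℂ))‖ ≤ (gammaPs d a')⁻¹ * δ * (gammaPs d a')⁻¹ := by
  have hg : 0 ≤ (gammaPs d a')⁻¹ := inv_nonneg.mpr (gammaPs_pos (d := d) (a' := a')).1.le
  rw [zeroth_consistency_decomp0, ← siteMul_sub]
  have e : Gps (R * N) M a' ⊗ₖ (1 : Matrix o o ℂ) * (siteMul (fun i => z' i - (z ∘ par N R M) i) * JK0 N R M ⊗ₖ (1 : Matrix o o ℂ))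
        * (Gps N M a' ⊗ₖ (1 : Matrix o o ℂ))
      = (Gps (R * N) M a' ⊗ₖ (1 : Matrix o o ℂ) * siteMul (fun i => z' i - (z ∘ par N R M) i)) * (JK0 N R M ⊗ₖ (1 : Matrix o o ℂ))
        * (Gps N M a' ⊗ₖ (1 : Matrix o o ℂ)) := by simp only [Matrix.mul_assoc]
  rw [e]
  calc _ ≤ ‖Gps (R * N) M a' ⊗ₖ (1 : Matrix o o ℂ) * siteMul (fun i => z' i - (z ∘ par N R M) i)‖ * ‖JK0 N R M ⊗ₖ (1 : Matrix o o ℂ)‖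
          * ‖Gps N M a' ⊗ₖ (1 : Matrix o o ℂ)‖ :=
        (Matrix.l2_opNorm_mul _ _).trans (mul_le_mul_of_nonneg_right (Matrix.l2_opNorm_mul _ _) (norm_nonneg _))
    _ ≤ ((gammaPs d a')⁻¹ * δ) * 1 * (gammaPs d a')⁻¹ := by
        refine mul_le_mul (mul_le_mul ((Matrix.l2_opNorm_mul _ _).trans (mul_le_mul (opNorm_kron_le_of_le o (opNorm_Gps_le _ M ha'))
          (opNorm_siteMul_le _ hδ hcons) (norm_nonneg _) hg)) (opNorm_kron_le_of_le o (opNorm_JK0_le N R M)) (norm_nonneg _)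
          (by positivity)) (opNorm_kron_le_of_le o (opNorm_Gps_le N M ha')) (norm_nonneg _) (by positivity)
    _ = _ := by ring

/-! ## §2 First order -/

/-- **THE EXACT TWO-LEVEL DECOMPOSITION** (first-order shape, colour 0-forms): with `v̄ = v ∘ par`,
`siteMul v′·∂′J₀ − J₀·siteMul v·∂ = R·(siteMul v′ − siteMul v̄)·(F₀J₀)·∂ + (1 − Π₀)·((R·F₀ − 1)J₀)·siteMul v·∂`
(`∂′J₀ = R·F₀J₀∂`, `J₀·siteMul v = siteMul v̄·J₀`, `Π₀(R·F₀ − 1)J₀ = 0`). [folklore] -/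
theorem consistency_decomp0 (hd : 1 ≤ d) (hN : 1 ≤ N) (μ : Fin d) (v' : Tor (fine (R * N) M) → Matrix o o ℂ)
    (v : Tor (fine N M) → Matrix o o ℂ) :
    siteMul v' * sdiff (fine (R * N) M) (((R * N : ℕ)) : ℂ) μ ⊗ₖ (1 : Matrix o o ℂ) * JK0 N R M ⊗ₖ (1 : Matrix o o ℂ)
        - JK0 N R M ⊗ₖ (1 : Matrix o o ℂ) * (siteMul v * sdiff (fine N M) ((N : ℕ) : ℂ) μ ⊗ₖ (1 : Matrix o o ℂ))
      = ((R : ℂ)) • ((siteMul v' - siteMul (v ∘ par N R M)) * (faceF0 N R M μ * JK0 N R M) ⊗ₖ (1 : Matrix o o ℂ)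
            * sdiff (fine N M) ((N : ℕ) : ℂ) μ ⊗ₖ (1 : Matrix o o ℂ))
        + (1 - Pi0 N R M) ⊗ₖ (1 : Matrix o o ℂ) * (((((R : ℂ)) • faceF0 N R M μ - 1) * JK0 N R M) ⊗ₖ (1 : Matrix o o ℂ)
            * siteMul v * sdiff (fine N M) ((N : ℕ) : ℂ) μ ⊗ₖ (1 : Matrix o o ℂ)) := by
  -- abbreviations
  set Sf := sdiff (fine (R * N) M) (((R * N : ℕ)) : ℂ) μ ⊗ₖ (1 : Matrix o o ℂ) with hSf
  set Sc := sdiff (fine N M) ((N : ℕ) : ℂ) μ ⊗ₖ (1 : Matrix o o ℂ) with hSc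
  set J := JK0 N R M ⊗ₖ (1 : Matrix o o ℂ) with hJ
  set Fk := faceF0 N R M μ ⊗ₖ (1 : Matrix o o ℂ) with hFk
  -- the three exact facts
  have h1 : Sf * J = ((R : ℂ)) • (Fk * J * Sc) := by
    rw [hSf, hJ, hFk, hSc, ← kron_mul, sdiff_mul_JK0 N R M hN μ, Matrix.smul_kronecker, kron_mul, kron_mul]
  have h2 : J * siteMul v = siteMul (v ∘ par N R M) * J := kronJK0_mul_siteMul N R M v
  have h3 : (1 - Pi0 N R M) ⊗ₖ (1 : Matrix o o ℂ) * ((((R : ℂ)) • faceF0 N R M μ - 1) * JK0 N R M) ⊗ₖ (1 : Matrix o o ℂ)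
      = ((((R : ℂ)) • faceF0 N R M μ - 1) * JK0 N R M) ⊗ₖ (1 : Matrix o o ℂ) := by
    rw [← kron_mul, Matrix.sub_mul, Matrix.one_mul, ← Matrix.mul_assoc, Pi0_mul_face_defect_mul_JK0 N R M hd μ, sub_zero]
  have h4 : ((((R : ℂ)) • faceF0 N R M μ - 1) * JK0 N R M) ⊗ₖ (1 : Matrix o o ℂ) * siteMul v
      = siteMul (v ∘ par N R M) * ((((R : ℂ)) • Fk - 1) * J) := by
    rw [kron_mul, Matrix.mul_assoc, ← hJ, h2, ← Matrix.mul_assoc, faceDefect_kron_mul_siteMul, Matrix.mul_assoc, sub_kronecker,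
      Matrix.smul_kronecker, Matrix.one_kronecker_one]
  -- normal forms
  have hL : siteMul v' * Sf * J - J * (siteMul v * Sc)
      = ((R : ℂ)) • (siteMul v' * (Fk * (J * Sc))) - siteMul (v ∘ par N R M) * (J * Sc) := by
    rw [Matrix.mul_assoc, h1, ← Matrix.mul_assoc J, h2, Matrix.mul_smul]
    simp only [Matrix.mul_assoc]
  have hR : ((R : ℂ)) • ((siteMul v' - siteMul (v ∘ par N R M)) * (faceF0 N R M μ * JK0 N R M) ⊗ₖ (1 : Matrix o o ℂ) * Sc)
        + (1 - Pi0 N R M) ⊗ₖ (1 : Matrix o o ℂ) * (((((R : ℂ)) • faceF0 N R M μ - 1) * JK0 N R M) ⊗ₖ (1 : Matrix o o ℂ)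
            * siteMul v * Sc)
      = ((R : ℂ)) • (siteMul v' * (Fk * (J * Sc))) - ((R : ℂ)) • (siteMul (v ∘ par N R M) * (Fk * (J * Sc)))
        + (((R : ℂ)) • (siteMul (v ∘ par N R M) * (Fk * (J * Sc))) - siteMul (v ∘ par N R M) * (J * Sc)) := by
    congr 1
    · rw [kron_mul, ← hFk, ← hJ, Matrix.sub_mul, Matrix.sub_mul, smul_sub]
      simp only [Matrix.mul_assoc]
    · rw [← Matrix.mul_assoc, ← Matrix.mul_assoc, h3, h4]
      simp only [Matrix.sub_mul, Matrix.mul_sub, Matrix.smul_mul, Matrix.mul_smul, Matrix.one_mul, Matrix.mul_assoc]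
  rw [hL, hR]
  abel

/-- **FIRST-ORDER (H-cons) AT TWO LEVELS** (colour 0-forms, per direction): for coefficient fields with `‖v‖ ≤ α` (coarse) and
`‖v′(x′) − v(par x′)‖ ≤ δ`, and the lifted complement number `‖(G′_{RN}(1 − Π₀)) ⊗ 1‖ ≤ e_c` of the free scalar tower,
`‖(G′_{RN} ⊗ 1)·(siteMul v′·∂′_μJ₀ − J₀·siteMul v·∂_μ)·(G′_N ⊗ 1)‖ ≤ R·g·δ·√g + e_c·(R + 1)·α·√g`. [folklore] -/
theorem opNorm_consistency0_le (hd : 1 ≤ d) (hN : 1 ≤ N) {a' : ℝ} (ha' : 0 < a') (μ : Fin d)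
    {v' : Tor (fine (R * N) M) → Matrix o o ℂ} {v : Tor (fine N M) → Matrix o o ℂ} {α δ ec : ℝ} (hα : 0 ≤ α) (hδ : 0 ≤ δ)
    (hv : ∀ x, ‖v x‖ ≤ α) (hcons : ∀ x', ‖v' x' - v (par N R M x')‖ ≤ δ)
    (hc : ‖(Gps (R * N) M a' * (1 - Pi0 N R M)) ⊗ₖ (1 : Matrix o o ℂ)‖ ≤ ec) :
    ‖Gps (R * N) M a' ⊗ₖ (1 : Matrix o o ℂ)
        * (siteMul v' * sdiff (fine (R * N) M) (((R * N : ℕ)) : ℂ) μ ⊗ₖ (1 : Matrix o o ℂ) * JK0 N R M ⊗ₖ (1 : Matrix o o ℂ)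
            - JK0 N R M ⊗ₖ (1 : Matrix o o ℂ) * (siteMul v * sdiff (fine N M) ((N : ℕ) : ℂ) μ ⊗ₖ (1 : Matrix o o ℂ)))
        * (Gps N M a' ⊗ₖ (1 : Matrix o o ℂ))‖
      ≤ R * (gammaPs d a')⁻¹ * δ * Real.sqrt ((gammaPs d a')⁻¹) + ec * (R + 1) * α * Real.sqrt ((gammaPs d a')⁻¹) := by
  have hg : 0 ≤ (gammaPs d a')⁻¹ := inv_nonneg.mpr (gammaPs_pos (d := d) (a' := a')).1.le
  have hec : 0 ≤ ec := (norm_nonneg _).trans hc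
  set G' := Gps (R * N) M a' ⊗ₖ (1 : Matrix o o ℂ) with hG'
  set G := Gps N M a' ⊗ₖ (1 : Matrix o o ℂ) with hG
  set Sc := sdiff (fine N M) ((N : ℕ) : ℂ) μ ⊗ₖ (1 : Matrix o o ℂ) with hSc
  have hSG : ‖Sc * G‖ ≤ Real.sqrt ((gammaPs d a')⁻¹) := by
    rw [hSc, hG, ← kron_mul]; exact opNorm_kron_le_of_le o (opNorm_sdiff_mul_Gps_le N M ha' μ)
  have hG'n : ‖G'‖ ≤ (gammaPs d a')⁻¹ := opNorm_kron_le_of_le o (opNorm_Gps_le _ M ha')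
  rw [consistency_decomp0 N R M hd hN μ v' v, Matrix.mul_add, Matrix.add_mul]
  refine (norm_add_le _ _).trans (add_le_add ?_ ?_)
  · -- `R • G' (Δ siteMul) (F₀J₀ ⊗ 1) ∂ G`
    rw [Matrix.mul_smul, Matrix.smul_mul, norm_smul, Complex.norm_natCast, ← siteMul_sub]
    have e : G' * (siteMul (fun i => v' i - (v ∘ par N R M) i) * (faceF0 N R M μ * JK0 N R M) ⊗ₖ (1 : Matrix o o ℂ) * Sc) * G
        = (G' * siteMul (fun i => v' i - (v ∘ par N R M) i)) * ((faceF0 N R M μ * JK0 N R M) ⊗ₖ (1 : Matrix o o ℂ)) * (Sc * G) := by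
      simp only [Matrix.mul_assoc]
    rw [e]
    have hA : ‖G' * siteMul (fun i => v' i - (v ∘ par N R M) i)‖ ≤ (gammaPs d a')⁻¹ * δ :=
      (Matrix.l2_opNorm_mul _ _).trans (mul_le_mul hG'n (opNorm_siteMul_le _ hδ hcons) (norm_nonneg _) hg)
    have hB : ‖(faceF0 N R M μ * JK0 N R M) ⊗ₖ (1 : Matrix o o ℂ)‖ ≤ 1 :=
      opNorm_kron_le_of_le o ((Matrix.l2_opNorm_mul _ _).trans ((mul_le_mul (opNorm_faceF0_le N R M μ) (opNorm_JK0_le N R M)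
        (norm_nonneg _) zero_le_one).trans (le_of_eq (one_mul 1))))
    calc (R : ℝ) * ‖G' * siteMul (fun i => v' i - (v ∘ par N R M) i) * (faceF0 N R M μ * JK0 N R M) ⊗ₖ (1 : Matrix o o ℂ) * (Sc * G)‖
        ≤ R * (((gammaPs d a')⁻¹ * δ) * 1 * Real.sqrt ((gammaPs d a')⁻¹)) := by
          refine mul_le_mul_of_nonneg_left ((Matrix.l2_opNorm_mul _ _).trans (mul_le_mul ((Matrix.l2_opNorm_mul _ _).trans
            (mul_le_mul hA hB (norm_nonneg _) (by positivity))) hSG (norm_nonneg _) (by positivity))) (Nat.cast_nonneg R)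
      _ = R * (gammaPs d a')⁻¹ * δ * Real.sqrt ((gammaPs d a')⁻¹) := by ring
  · -- `G'(1 − Π₀) ((R F₀ − 1)J₀ ⊗ 1) siteMul v ∂ G`
    have e : G' * ((1 - Pi0 N R M) ⊗ₖ (1 : Matrix o o ℂ) * (((((R : ℂ)) • faceF0 N R M μ - 1) * JK0 N R M) ⊗ₖ (1 : Matrix o o ℂ)
          * siteMul v * Sc)) * G
        = (G' * (1 - Pi0 N R M) ⊗ₖ (1 : Matrix o o ℂ)) * (((((R : ℂ)) • faceF0 N R M μ - 1) * JK0 N R M) ⊗ₖ (1 : Matrix o o ℂ)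
          * siteMul v) * (Sc * G) := by
      simp only [Matrix.mul_assoc]
    rw [e]
    have hA : ‖G' * (1 - Pi0 N R M) ⊗ₖ (1 : Matrix o o ℂ)‖ ≤ ec := by rw [hG', ← kron_mul]; exact hc
    have hB : ‖((((R : ℂ)) • faceF0 N R M μ - 1) * JK0 N R M) ⊗ₖ (1 : Matrix o o ℂ) * siteMul v‖ ≤ (R + 1) * 1 * α :=
      (Matrix.l2_opNorm_mul _ _).trans (mul_le_mul (opNorm_kron_le_of_le o ((Matrix.l2_opNorm_mul _ _).trans (mul_le_mul
        (opNorm_faceDefect0_le N R M μ) (opNorm_JK0_le N R M) (norm_nonneg _) (by positivity)))) (opNorm_siteMul_le _ hα hv)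
        (norm_nonneg _) (by positivity))
    calc _ ≤ ‖G' * (1 - Pi0 N R M) ⊗ₖ (1 : Matrix o o ℂ)‖
            * ‖((((R : ℂ)) • faceF0 N R M μ - 1) * JK0 N R M) ⊗ₖ (1 : Matrix o o ℂ) * siteMul v‖ * ‖Sc * G‖ :=
          (Matrix.l2_opNorm_mul _ _).trans (mul_le_mul_of_nonneg_right (Matrix.l2_opNorm_mul _ _) (norm_nonneg _))
      _ ≤ ec * ((R + 1) * 1 * α) * Real.sqrt ((gammaPs d a')⁻¹) :=
          mul_le_mul (mul_le_mul hA hB (norm_nonneg _) hec) hSG (norm_nonneg _) (by positivity)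
      _ = ec * (R + 1) * α * Real.sqrt ((gammaPs d a')⁻¹) := by ring

/-! ## §3 Adjoint first order -/

/-- **THE EXACT TWO-LEVEL DECOMPOSITION** (adjoint shape, colour 0-forms):
`∂′ᴴ·siteMul v′·J₀ − J₀·(∂ᴴ·siteMul v) = ∂′ᴴ·(siteMul v′ − siteMul v̄)·J₀ + (1 − Π₀)·((∂′ᴴJ₀ − J₀∂ᴴ) ⊗ 1)·siteMul v`. [folklore] -/
theorem adjoint_consistency_decomp0 (hd : 1 ≤ d) (hN : 1 ≤ N) (μ : Fin d) (v' : Tor (fine (R * N) M) → Matrix o o ℂ)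
    (v : Tor (fine N M) → Matrix o o ℂ) :
    (sdiff (fine (R * N) M) (((R * N : ℕ)) : ℂ) μ ⊗ₖ (1 : Matrix o o ℂ))ᴴ * siteMul v' * JK0 N R M ⊗ₖ (1 : Matrix o o ℂ)
        - JK0 N R M ⊗ₖ (1 : Matrix o o ℂ) * ((sdiff (fine N M) ((N : ℕ) : ℂ) μ ⊗ₖ (1 : Matrix o o ℂ))ᴴ * siteMul v)
      = (sdiff (fine (R * N) M) (((R * N : ℕ)) : ℂ) μ ⊗ₖ (1 : Matrix o o ℂ))ᴴ * (siteMul v' - siteMul (v ∘ par N R M))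
            * JK0 N R M ⊗ₖ (1 : Matrix o o ℂ)
        + (1 - Pi0 N R M) ⊗ₖ (1 : Matrix o o ℂ)
            * (((sdiff (fine (R * N) M) (((R * N : ℕ)) : ℂ) μ)ᴴ * JK0 N R M - JK0 N R M * (sdiff (fine N M) ((N : ℕ) : ℂ) μ)ᴴ)
                ⊗ₖ (1 : Matrix o o ℂ) * siteMul v) := by
  set SfH := (sdiff (fine (R * N) M) (((R * N : ℕ)) : ℂ) μ ⊗ₖ (1 : Matrix o o ℂ))ᴴ with hSfH
  set ScH := (sdiff (fine N M) ((N : ℕ) : ℂ) μ ⊗ₖ (1 : Matrix o o ℂ))ᴴ with hScH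
  set J := JK0 N R M ⊗ₖ (1 : Matrix o o ℂ) with hJ
  have h2 : J * siteMul v = siteMul (v ∘ par N R M) * J := kronJK0_mul_siteMul N R M v
  have h3 : (1 - Pi0 N R M) ⊗ₖ (1 : Matrix o o ℂ)
        * (((sdiff (fine (R * N) M) (((R * N : ℕ)) : ℂ) μ)ᴴ * JK0 N R M - JK0 N R M * (sdiff (fine N M) ((N : ℕ) : ℂ) μ)ᴴ)
            ⊗ₖ (1 : Matrix o o ℂ))
      = SfH * J - J * ScH := by
    rw [← kron_mul, Matrix.sub_mul (1 : Matrix _ _ ℂ), Matrix.one_mul, Pi0_mul_adjoint_defect0 N R M hd hN μ, sub_zero, sub_kronecker,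
      kron_mul, kron_mul, hSfH, hScH, hJ, kron_conjTranspose, kron_conjTranspose]
  rw [← Matrix.mul_assoc ((1 - Pi0 N R M) ⊗ₖ (1 : Matrix o o ℂ)), h3]
  have e1 : (SfH * J - J * ScH) * siteMul v = SfH * (siteMul (v ∘ par N R M) * J) - J * (ScH * siteMul v) := by
    rw [Matrix.sub_mul, Matrix.mul_assoc, h2, Matrix.mul_assoc]
  rw [e1, Matrix.mul_sub, Matrix.sub_mul]
  simp only [Matrix.mul_assoc]
  abel

/-- **ADJOINT FIRST-ORDER (H-cons) AT TWO LEVELS** (colour 0-forms, per direction): for `‖v‖ ≤ α`, `‖v(· + e_μ) − v‖ ≤ β/N` (coarse),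
`‖v′ − v ∘ par‖ ≤ δ` and the lifted complement number `e_c`:
`‖(G′_{RN} ⊗ 1)·(∂′_μᴴ·siteMul v′·J₀ − J₀·∂_μᴴ·siteMul v)·(G′_N ⊗ 1)‖ ≤ √g·δ·g + e_c·(R + 1)·(α√g + βg)`. [folklore] -/
theorem opNorm_adjoint_consistency0_le (hd : 1 ≤ d) (hN : 1 ≤ N) {a' : ℝ} (ha' : 0 < a') (μ : Fin d)
    {v' : Tor (fine (R * N) M) → Matrix o o ℂ} {v : Tor (fine N M) → Matrix o o ℂ} {α β δ ec : ℝ} (hα : 0 ≤ α) (hβ : 0 ≤ β)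
    (hδ : 0 ≤ δ) (hv : ∀ x, ‖v x‖ ≤ α) (hvd : ∀ x, ‖v (x + unitVec (fine N M) μ) - v x‖ ≤ β / N)
    (hcons : ∀ x', ‖v' x' - v (par N R M x')‖ ≤ δ) (hc : ‖(Gps (R * N) M a' * (1 - Pi0 N R M)) ⊗ₖ (1 : Matrix o o ℂ)‖ ≤ ec) :
    ‖Gps (R * N) M a' ⊗ₖ (1 : Matrix o o ℂ)
        * ((sdiff (fine (R * N) M) (((R * N : ℕ)) : ℂ) μ ⊗ₖ (1 : Matrix o o ℂ))ᴴ * siteMul v' * JK0 N R M ⊗ₖ (1 : Matrix o o ℂ)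
            - JK0 N R M ⊗ₖ (1 : Matrix o o ℂ) * ((sdiff (fine N M) ((N : ℕ) : ℂ) μ ⊗ₖ (1 : Matrix o o ℂ))ᴴ * siteMul v))
        * (Gps N M a' ⊗ₖ (1 : Matrix o o ℂ))‖
      ≤ Real.sqrt ((gammaPs d a')⁻¹) * δ * (gammaPs d a')⁻¹
        + ec * (R + 1) * (α * Real.sqrt ((gammaPs d a')⁻¹) + β * (gammaPs d a')⁻¹) := by
  have hg : 0 ≤ (gammaPs d a')⁻¹ := inv_nonneg.mpr (gammaPs_pos (d := d) (a' := a')).1.le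
  have hec : 0 ≤ ec := (norm_nonneg _).trans hc
  set G' := Gps (R * N) M a' ⊗ₖ (1 : Matrix o o ℂ) with hG'
  set G := Gps N M a' ⊗ₖ (1 : Matrix o o ℂ) with hG
  set Sf := sdiff (fine (R * N) M) (((R * N : ℕ)) : ℂ) μ ⊗ₖ (1 : Matrix o o ℂ) with hSf
  set Sc := sdiff (fine N M) ((N : ℕ) : ℂ) μ ⊗ₖ (1 : Matrix o o ℂ) with hSc
  set J := JK0 N R M ⊗ₖ (1 : Matrix o o ℂ) with hJ
  have hB := opNorm_kronSdiff_siteMul_Gps_le N M ha' μ hα hβ hv hvd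
  have hBH := opNorm_kronSdiffH_siteMul_Gps_le N M ha' μ hα hβ hv hvd
  have hBn : 0 ≤ α * Real.sqrt ((gammaPs d a')⁻¹) + β * (gammaPs d a')⁻¹ := by positivity
  have hJn : ‖J‖ ≤ 1 := opNorm_kron_le_of_le o (opNorm_JK0_le N R M)
  have hGn : ‖G‖ ≤ (gammaPs d a')⁻¹ := opNorm_kron_le_of_le o (opNorm_Gps_le N M ha')
  rw [adjoint_consistency_decomp0 N R M hd hN μ v' v, Matrix.mul_add, Matrix.add_mul]
  refine (norm_add_le _ _).trans (add_le_add ?_ ?_)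
  · -- `G' ∂'ᴴ (Δ siteMul) J G`
    rw [← siteMul_sub]
    have e : G' * (Sfᴴ * siteMul (fun i => v' i - (v ∘ par N R M) i) * J) * G
        = (G' * Sfᴴ) * siteMul (fun i => v' i - (v ∘ par N R M) i) * (J * G) := by simp only [Matrix.mul_assoc]
    rw [e]
    have hA : ‖G' * Sfᴴ‖ ≤ Real.sqrt ((gammaPs d a')⁻¹) := by
      rw [hG', hSf, kron_conjTranspose, ← kron_mul]; exact opNorm_kron_le_of_le o (opNorm_Gps_mul_sdiffH_le _ M ha' μ)
    calc _ ≤ ‖G' * Sfᴴ‖ * ‖siteMul (fun i => v' i - (v ∘ par N R M) i)‖ * ‖J * G‖ :=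
          (Matrix.l2_opNorm_mul _ _).trans (mul_le_mul_of_nonneg_right (Matrix.l2_opNorm_mul _ _) (norm_nonneg _))
      _ ≤ Real.sqrt ((gammaPs d a')⁻¹) * δ * (1 * (gammaPs d a')⁻¹) :=
          mul_le_mul (mul_le_mul hA (opNorm_siteMul_le _ hδ hcons) (norm_nonneg _) (Real.sqrt_nonneg _))
            ((Matrix.l2_opNorm_mul _ _).trans (mul_le_mul hJn hGn (norm_nonneg _) zero_le_one)) (norm_nonneg _) (by positivity)
      _ = _ := by ring
  · -- `G'(1 − Π₀) · (∂'ᴴJ₀ − J₀∂ᴴ) siteMul v G`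
    have hdef : (((sdiff (fine (R * N) M) (((R * N : ℕ)) : ℂ) μ)ᴴ * JK0 N R M - JK0 N R M * (sdiff (fine N M) ((N : ℕ) : ℂ) μ)ᴴ)
          ⊗ₖ (1 : Matrix o o ℂ)) = Sfᴴ * J - J * Scᴴ := by
      rw [sub_kronecker, kron_mul, kron_mul, hSf, hSc, hJ, kron_conjTranspose, kron_conjTranspose]
    have e : G' * ((1 - Pi0 N R M) ⊗ₖ (1 : Matrix o o ℂ)
          * ((((sdiff (fine (R * N) M) (((R * N : ℕ)) : ℂ) μ)ᴴ * JK0 N R M - JK0 N R M * (sdiff (fine N M) ((N : ℕ) : ℂ) μ)ᴴ)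
              ⊗ₖ (1 : Matrix o o ℂ)) * siteMul v)) * G
        = (G' * (1 - Pi0 N R M) ⊗ₖ (1 : Matrix o o ℂ)) * ((Sfᴴ * J - J * Scᴴ) * siteMul v * G) := by
      rw [hdef]; simp only [Matrix.mul_assoc]
    rw [e]
    have hA : ‖G' * (1 - Pi0 N R M) ⊗ₖ (1 : Matrix o o ℂ)‖ ≤ ec := by rw [hG', ← kron_mul]; exact hc
    -- the planted backward-difference defect through `siteMul v` and one propagator
    have h1 : Sf * J = ((R : ℂ)) • (faceF0 N R M μ ⊗ₖ (1 : Matrix o o ℂ) * J * Sc) := by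
      rw [hSf, hJ, hSc, ← kron_mul, sdiff_mul_JK0 N R M hN μ, Matrix.smul_kronecker, kron_mul, kron_mul]
    have hX1 : ‖Sfᴴ * J * siteMul v * G‖ ≤ R * (α * Real.sqrt ((gammaPs d a')⁻¹) + β * (gammaPs d a')⁻¹) := by
      have e1 : Sfᴴ * J * siteMul v * G
          = -(((R : ℂ)) • ((shiftS (fine (R * N) M) μ ⊗ₖ (1 : Matrix o o ℂ))ᴴ * (faceF0 N R M μ ⊗ₖ (1 : Matrix o o ℂ) * J)
              * (Sc * siteMul v * G))) := by
        rw [hSf, kronSdiff_conjTranspose, ← hSf, Matrix.neg_mul, Matrix.neg_mul, Matrix.neg_mul, Matrix.mul_assoc _ Sf J, h1,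
          Matrix.mul_smul, Matrix.smul_mul, Matrix.smul_mul]
        simp only [Matrix.mul_assoc]
      rw [e1, norm_neg, norm_smul, Complex.norm_natCast]
      refine mul_le_mul_of_nonneg_left ?_ (Nat.cast_nonneg R)
      calc _ ≤ ‖(shiftS (fine (R * N) M) μ ⊗ₖ (1 : Matrix o o ℂ))ᴴ * (faceF0 N R M μ ⊗ₖ (1 : Matrix o o ℂ) * J)‖ * ‖Sc * siteMul v * G‖ :=
            Matrix.l2_opNorm_mul _ _
        _ ≤ 1 * (α * Real.sqrt ((gammaPs d a')⁻¹) + β * (gammaPs d a')⁻¹) := by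
            refine mul_le_mul ?_ hB (norm_nonneg _) zero_le_one
            refine (Matrix.l2_opNorm_mul _ _).trans ?_
            calc ‖(shiftS (fine (R * N) M) μ ⊗ₖ (1 : Matrix o o ℂ))ᴴ‖ * ‖faceF0 N R M μ ⊗ₖ (1 : Matrix o o ℂ) * J‖ ≤ 1 * (1 * 1) := by
                  refine mul_le_mul ?_ ((Matrix.l2_opNorm_mul _ _).trans (mul_le_mul (opNorm_kron_le_of_le o (opNorm_faceF0_le N R M μ))
                    hJn (norm_nonneg _) zero_le_one)) (norm_nonneg _) zero_le_one
                  rw [Matrix.l2_opNorm_conjTranspose]; exact opNorm_kron_le_of_le o (opNorm_shiftS_le _ μ)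
              _ = 1 := by ring
        _ = _ := one_mul _
    have hX2 : ‖J * Scᴴ * siteMul v * G‖ ≤ α * Real.sqrt ((gammaPs d a')⁻¹) + β * (gammaPs d a')⁻¹ := by
      rw [Matrix.mul_assoc, Matrix.mul_assoc]
      calc _ ≤ ‖J‖ * ‖Scᴴ * (siteMul v * G)‖ := Matrix.l2_opNorm_mul _ _
        _ ≤ 1 * (α * Real.sqrt ((gammaPs d a')⁻¹) + β * (gammaPs d a')⁻¹) := by
            refine mul_le_mul hJn ?_ (norm_nonneg _) zero_le_one
            rw [← Matrix.mul_assoc]; exact hBH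
        _ = _ := one_mul _
    have hX : ‖(Sfᴴ * J - J * Scᴴ) * siteMul v * G‖ ≤ (R + 1) * (α * Real.sqrt ((gammaPs d a')⁻¹) + β * (gammaPs d a')⁻¹) := by
      rw [Matrix.sub_mul, Matrix.sub_mul]
      refine (norm_sub_le _ _).trans ((add_le_add hX1 hX2).trans (le_of_eq (by ring)))
    calc _ ≤ ‖G' * (1 - Pi0 N R M) ⊗ₖ (1 : Matrix o o ℂ)‖ * ‖(Sfᴴ * J - J * Scᴴ) * siteMul v * G‖ := Matrix.l2_opNorm_mul _ _
      _ ≤ ec * ((R + 1) * (α * Real.sqrt ((gammaPs d a')⁻¹) + β * (gammaPs d a')⁻¹)) :=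
          mul_le_mul hA hX (norm_nonneg _) hec
      _ = _ := by ring

end TwoLevel

end Summit.QuantumFields.BalabanUV.T4Continuum.ScalarPlantingConsistency

end
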